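import Summits.QuantumFields.GaugeBoot.DiagonalRPFiniteVolume
import HarnessLib

/-!
# Diagonal reflection positivity of the FREE-boundary Wilson state of a symmetric box
(gauge-boot, L3(β): the statement of the plan row, "diagonal-plane RP for diagonal-symmetric free boxes")

HONEST FRAMING (cell `pub-gaugeboot`, page 1 of every file): the venture produces certified bounds
on lattice expectations at stated coupling, gauge group, dimension and torus size; NOT a mass gap,
NOT a continuum limit, NOT a string tension; NOT Yang–Mills-summit-bearing (barriers
`FixedCouplingUltralocality`, `PerturbativeInvisibility`).

`DiagonalRPFiniteVolume.lean` proves diagonal RP for the DLR kernel `ymSpecification ρ β Λ η`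
(boundary Wilson action: all plaquettes TOUCHING `Λ`, outside links frozen to a swap-symmetric `η`).
This file records the FREE boundary condition (only the plaquettes INSIDE `Λ` interact), which is
the setting quoted in the plan (Osterwalder–Seiler 1978 §2; Kazakov–Zheng arXiv:2404.16925 p. 10:
"plaquettes cut by the diagonal expand positively"):

* `interiorPlaquettes Λ` — the plaquettes all four of whose links lie in `Λ` (a `plaqSwap`-symmetric
  set when `Λ` is `edgeSwap`-symmetric, `plaqSwap_mem_interiorPlaquettes`);
* `freeWilsonKernel ρ β Λ` — the free-boundary finite-volume Wilson state on `LGConfig d G`: product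
  Haar measure on the links of `Λ` (links off `Λ` frozen to `1`), tilted by
  `exp(β ∑_{p ⊂ Λ} Re tr ρ(U_p))` — a probability measure (`isProbabilityMeasure_freeWilsonKernel`);
* `isReflectionPositiveFor_diag_freeWilsonKernel` — for `G` compact second countable, `ρ`
  continuous, `β ≥ 0`, `i ≠ j` and `Λ` `edgeSwap i j`-symmetric:
  `IsReflectionPositiveFor (configDiagSwapZd i j) (diagHalfEdges i j) (freeWilsonKernel ρ β Λ)`;
  in particular for the cube of links based in `[-R, R]^d` (`…_box`).

The proof is the generic core `DiagRP.integral_exp_sum_mul_nonneg` of `DiagonalRPFiniteVolume.lean`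
(stated there for ANY symmetric plaquette set `Q`) with `Q = interiorPlaquettes Λ` and `η = 1`.
No infinite-volume statement is made.

References: K. Osterwalder, E. Seiler, Ann. Phys. 110 (1978) 440, §2; E. Seiler, LNP 159 (1982)
Ch. 2 (free and other boundary conditions); V. Kazakov, Z. Zheng, arXiv:2404.16925 §3.2 (p. 10).
-/

noncomputable section

open MeasureTheory Complex
open scoped ComplexOrder ComplexConjugate
open Literature.Probability.LatticeModels (box glueWith measurable_glueWith)
open Literature.MathematicalPhysics.QuantumLattice
open Literature.MathematicalPhysics.QuantumFieldTheory (haarProbability)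

namespace Summit.QuantumFields.GaugeBoot

namespace DiagRP

variable {d N : ℕ} {i j : Fin d} {G : Type*} [Group G] [TopologicalSpace G] [IsTopologicalGroup G]
  [CompactSpace G] [MeasurableSpace G] [BorelSpace G] [SecondCountableTopology G]
variable (ρ : G →* Matrix (Fin N) (Fin N) ℂ)

/-! ## The free-boundary kernel -/

/-- The plaquettes lying INSIDE the finite link set `Λ` (all four links in `Λ`). -/
def interiorPlaquettes (Λ : Finset (ZdEdge d)) : Finset (ZdPlaquette d) :=
  (plaquettesTouching Λ).filter fun p => plaquetteEdges p ⊆ Λ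

omit [Group G] [TopologicalSpace G] [IsTopologicalGroup G] [CompactSpace G] [MeasurableSpace G]
  [BorelSpace G] [SecondCountableTopology G] in
/-- Membership: `p` is interior iff all its links lie in `Λ`. -/
theorem mem_interiorPlaquettes_iff {Λ : Finset (ZdEdge d)} {p : ZdPlaquette d} :
    p ∈ interiorPlaquettes Λ ↔ plaquetteEdges p ⊆ Λ := by
  rw [interiorPlaquettes, Finset.mem_filter, mem_plaquettesTouching_iff]
  constructor
  · exact fun h => h.2
  · intro h
    refine ⟨⟨(p.1, p.2.1.1), Finset.mem_inter.2 ⟨?_, h ?_⟩⟩, h⟩ <;>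
      exact (mem_plaquetteEdges_iff p _).2 (Or.inl rfl)

omit [Group G] [TopologicalSpace G] [IsTopologicalGroup G] [CompactSpace G] [MeasurableSpace G]
  [BorelSpace G] [SecondCountableTopology G] in
/-- **The interior plaquettes of a swap-symmetric link set form a swap-symmetric set.** -/
theorem plaqSwap_mem_interiorPlaquettes {Λ : Finset (ZdEdge d)} (hΛ : ∀ e ∈ Λ, edgeSwap i j e ∈ Λ)
    {p : ZdPlaquette d} (hp : p ∈ interiorPlaquettes Λ) : plaqSwap i j p ∈ interiorPlaquettes Λ := by
  rw [mem_interiorPlaquettes_iff] at hp ⊢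
  rw [plaquetteEdges_plaqSwap]
  intro e he
  obtain ⟨e', he', rfl⟩ := Finset.mem_image.1 he
  exact hΛ e' (hp he')

/-- **The free-boundary finite-volume Wilson state** of the link set `Λ` at coupling `β`: product
Haar measure on the links of `Λ` (links off `Λ` frozen to `1`, so that the state is a measure on
`LGConfig d G`), tilted by `exp(β ∑_{p ∈ interiorPlaquettes Λ} Re tr ρ(U_p))`, i.e. by `exp(-β S)`
for the free Wilson action `S = ∑_{p ⊂ Λ} (N - Re tr ρ(U_p))` up to the constant `N #plaquettes`
(Seiler LNP 159 Ch. 2, free boundary conditions). -/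
def freeWilsonKernel (β : ℝ) (Λ : Finset (ZdEdge d)) : Measure (LGConfig d G) :=
  ((Measure.pi fun _ : ↥Λ => haarProbability G).map (glueWith Λ · (1 : LGConfig d G))).tilted
    fun U => β * ∑ p ∈ interiorPlaquettes Λ, plaquetteObs ρ p.1 p.2.1.1 p.2.1.2 U

omit [CompactSpace G] [MeasurableSpace G] [BorelSpace G] [SecondCountableTopology G] in
/-- The free tilting exponent is continuous. -/
theorem continuous_freeExponent (hρ : Continuous ρ) (β : ℝ) (Λ : Finset (ZdEdge d)) :
    Continuous fun U : LGConfig d G =>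
      β * ∑ p ∈ interiorPlaquettes Λ, plaquetteObs ρ p.1 p.2.1.1 p.2.1.2 U :=
  continuous_const.mul (continuous_finsetSum _ fun p _ => continuous_plaquetteObs ρ hρ p.1 p.2.1.1 p.2.1.2)

omit [MeasurableSpace G] [BorelSpace G] [SecondCountableTopology G] in
/-- The free tilting density is bounded: `exp(β ∑_Q Re tr ρ(U_p)) ≤ exp(|β| N #Q)`. -/
theorem exp_freeExponent_le (hρ : Continuous ρ) (β : ℝ) (Λ : Finset (ZdEdge d)) (U : LGConfig d G) :
    Real.exp (β * ∑ p ∈ interiorPlaquettes Λ, plaquetteObs ρ p.1 p.2.1.1 p.2.1.2 U) ≤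
      Real.exp (|β| * (N * (interiorPlaquettes Λ).card)) := by
  refine Real.exp_le_exp.2 ?_
  have h := abs_sum_filter_plaquetteObs_le ρ hρ (interiorPlaquettes Λ) (fun _ => True) U
  rw [Finset.filter_true_of_mem fun _ _ => trivial] at h
  calc β * ∑ p ∈ interiorPlaquettes Λ, plaquetteObs ρ p.1 p.2.1.1 p.2.1.2 U
      ≤ |β * ∑ p ∈ interiorPlaquettes Λ, plaquetteObs ρ p.1 p.2.1.1 p.2.1.2 U| := le_abs_self _
    _ = |β| * |∑ p ∈ interiorPlaquettes Λ, plaquetteObs ρ p.1 p.2.1.1 p.2.1.2 U| := abs_mul _ _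
    _ ≤ |β| * (N * (interiorPlaquettes Λ).card) := mul_le_mul_of_nonneg_left h (abs_nonneg _)

/-- The free tilting density is integrable against the (glued) product Haar measure. -/
theorem integrable_exp_freeExponent (hρ : Continuous ρ) (β : ℝ) (Λ : Finset (ZdEdge d)) :
    Integrable (fun U : LGConfig d G => Real.exp
        (β * ∑ p ∈ interiorPlaquettes Λ, plaquetteObs ρ p.1 p.2.1.1 p.2.1.2 U))
      ((Measure.pi fun _ : ↥Λ => haarProbability G).map (glueWith Λ · (1 : LGConfig d G))) := by
  haveI : IsProbabilityMeasure ((Measure.pi fun _ : ↥Λ => haarProbability G).map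
      (glueWith Λ · (1 : LGConfig d G))) :=
    Measure.isProbabilityMeasure_map (measurable_glueWith Λ _).aemeasurable
  refine Integrable.of_bound ((continuous_freeExponent ρ hρ β Λ).rexp.aestronglyMeasurable)
    (Real.exp (|β| * (N * (interiorPlaquettes Λ).card))) (ae_of_all _ fun U => ?_)
  rw [Real.norm_eq_abs, abs_of_pos (Real.exp_pos _)]
  exact exp_freeExponent_le ρ hρ β Λ U

/-- **The free-boundary kernel is a probability measure.** -/
theorem isProbabilityMeasure_freeWilsonKernel (hρ : Continuous ρ) (β : ℝ) (Λ : Finset (ZdEdge d)) :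
    IsProbabilityMeasure (freeWilsonKernel (G := G) ρ β Λ) := by
  haveI : IsProbabilityMeasure ((Measure.pi fun _ : ↥Λ => haarProbability G).map
      (glueWith Λ · (1 : LGConfig d G))) :=
    Measure.isProbabilityMeasure_map (measurable_glueWith Λ _).aemeasurable
  exact isProbabilityMeasure_tilted (integrable_exp_freeExponent ρ hρ β Λ)

/-! ## Diagonal reflection positivity -/

/-- **Diagonal RP of the free-boundary Wilson state of a symmetric box** (Osterwalder–Seiler 1978
§2; Kazakov–Zheng arXiv:2404.16925 p. 10): for `G` compact second countable, `ρ` continuous,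
`β ≥ 0`, `i ≠ j` and an `edgeSwap i j`-symmetric finite link set `Λ`,
`0 ≤ ∫ conj F(ΘU) F(U) dμ^free_{Λ,β}(U)` for every bounded measurable `F` depending only on the
links of the closed half `{x_i ≥ x_j}`. -/
theorem isReflectionPositiveFor_diag_freeWilsonKernel (hρ : Continuous ρ) (hij : i ≠ j) {β : ℝ}
    (hβ : 0 ≤ β) {Λ : Finset (ZdEdge d)} (hΛ : ∀ e ∈ Λ, edgeSwap i j e ∈ Λ) :
    IsReflectionPositiveFor (configDiagSwapZd i j) (diagHalfEdges i j)
      (freeWilsonKernel (G := G) ρ β Λ) := by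
  intro F hF hFb hFdep
  obtain ⟨CF, hFb⟩ := hFb
  set η : LGConfig d G := 1 with hη1
  have hη : configDiagSwapZd i j η = η := rfl
  have hg : Measurable (glueWith Λ · η : (↥Λ → G) → LGConfig d G) := measurable_glueWith Λ η
  have hw : Continuous fun U : LGConfig d G =>
      Real.exp (β * ∑ p ∈ interiorPlaquettes Λ, plaquetteObs ρ p.1 p.2.1.1 p.2.1.2 U) :=
    (continuous_freeExponent ρ hρ β Λ).rexp
  have hH : Measurable fun U : LGConfig d G => conj (F (configDiagSwapZd i j U)) * F U :=
    (Complex.continuous_conj.measurable.comp (hF.comp measurable_configDiagSwapZd)).mul hF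
  haveI : IsProbabilityMeasure ((Measure.pi fun _ : ↥Λ => haarProbability G).map
      (glueWith Λ · η)) := Measure.isProbabilityMeasure_map hg.aemeasurable
  have hZ : 0 < ∫ U, Real.exp (β * ∑ p ∈ interiorPlaquettes Λ, plaquetteObs ρ p.1 p.2.1.1 p.2.1.2 U)
      ∂((Measure.pi fun _ : ↥Λ => haarProbability G).map (glueWith Λ · η)) :=
    integral_exp_pos (integrable_exp_freeExponent ρ hρ β Λ)
  unfold freeWilsonKernel
  rw [integral_tilted, integral_map hg.aemeasurable]
  · simp_rw [Complex.real_smul, Complex.ofReal_div, div_eq_mul_inv, mul_comm (Complex.ofReal _)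
      ((_ : ℂ)⁻¹), mul_assoc]
    rw [integral_const_mul]
    refine mul_nonneg ?_ (integral_exp_sum_mul_nonneg ρ hρ hij hβ hΛ hη
      (fun p hp => plaqSwap_mem_interiorPlaquettes hΛ hp) hF hFb hFdep)
    rw [← Complex.ofReal_inv]
    exact Complex.zero_le_real.2 (inv_nonneg.2 hZ.le)
  · exact ((hw.measurable.div_const _).smul hH).aestronglyMeasurable

/-- **Corollary: the free-boundary Wilson state of the cube `[-R, R]^d` is reflection positive in
every diagonal hyperplane `x_i = x_j`** (`β ≥ 0`, `i ≠ j`). -/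
theorem isReflectionPositiveFor_diag_freeWilsonKernel_box (hρ : Continuous ρ) (hij : i ≠ j) {β : ℝ}
    (hβ : 0 ≤ β) (R : ℕ) :
    IsReflectionPositiveFor (configDiagSwapZd i j) (diagHalfEdges i j)
      (freeWilsonKernel (G := G) ρ β (box d R ×ˢ (Finset.univ : Finset (Fin d)))) :=
  isReflectionPositiveFor_diag_freeWilsonKernel ρ hρ hij hβ fun e he => edgeSwap_mem_box_product R e he

end DiagRP

end Summit.QuantumFields.GaugeBoot
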